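import Mathlib
import HarnessLib
import Literature.Analysis.FluidPDE.SelfSimilar
import Summits.NavierStokesRegularity.NavierStokesRegularity.Theorems.PoloidalWindowDoorPoloidalWindowRigidityPoloidalExtremal
import Summits.NavierStokesRegularity.NavierStokesRegularity.Theorems.SqueezeCycleExtremalElementExistsExtraction
import Summits.NavierStokesRegularity.NavierStokesRegularity.Theorems.PoloidalWindowDoorPoloidalWindowRigidityEternalCoreScalingCore
import Summits.NavierStokesRegularity.NavierStokesRegularity.Theorems.PoloidalWindowDoorPoloidalWindowRigidityEternalCoreScalingRecurrence

/-!
# Route `PoloidalWindowDoor`, crux `PoloidalWindowRigidity` (K2, stmt-NavierStokesRegularity-19708) — LINE 23 «eternal_core» (ns-idea-8 g11):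
# U2d `ScalingRecurrentCore` — the BLOW-DOWN HULL WITHOUT `0` IS SCALING-RECURRENT, VERBATIM (Cruxes-local `EternalCore` delta-unfolded)

Cell ns-regularity-ideate, seat ns-poloidal-K2-p2 g14 (K2 stub-worker hand; DIRECTOR-NS #291).  Statement = `ScalingRecurrentCore` of
`Cruxes/PoloidalWindowRigidity/Lines/eternal_core.lean` (f961ba0f8b44, l.283–299): a class profile `U` (Type-I constant `C`), e₂-poloidal, with the extremal
bound `√(−t)|U₂| ≤ M` and an eternal core `(ε₀, R₀)` before time `−1` has a blow-down limit `W = lim nsRescale (λₙ) U` (`λₙ ≥ n+1`, slice-wise locally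
uniformly) in the class, e₂-poloidal, with the same extremal bound and the eternal core in EVERY window `t₀ < 0`, which is SCALING-RECURRENT:
`nsRescale (μₙ) W → W` slice-wise along some `μₙ ≥ n+1`.

PROOF (the line card's, with the tree's Birkhoff–Furstenberg theorem in place of Zorn-by-hand; twin of H6 `…HotHullLeafRecurrence`).
* The BLOW-DOWN HULL `Ω`: class-`C`, poloidal, extremal profiles with the `(ε₀, R₀)`-core in every window `t₀ < 0` that are slice-wise locally uniform
  limits of `nsRescale (λₙ) U` along SOME `λₙ → ∞`.  Non-empty (KNSS extraction `…Theorems.exists_tendsto_of_isTypeIAncientMild_seq` along `λₙ = n+1`;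
  poloidality of the limit by gradient convergence `…PoloidalExtremal.poloidal_of_tendsto`; the core by `…EternalCoreScalingCore.eternalCore_of_limit`,
  the rescaled profile having it in the windows `t₀ < −λₙ⁻²`); invariant under every `nsRescale (e^σ)` (`…Theorems.isTypeIAncientMild_nsRescale`,
  `poloidal_nsRescale`, `extremal_nsRescale`, `eternalCore_nsRescale`, `nsRescale_mul`, continuity `tendsto_nsRescale_slices`); sequentially
  compact-and-closed (KNSS extraction + `scaling_diagonal`).
* Birkhoff (`…EternalCoreScalingRecurrence.exists_scaling_recurrent`) gives `W ∈ Ω` whose `(1/(m+1), slab m)`-return log-scales are relatively dense;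
  a return `σₘ ∈ [log (m+1), log (m+1) + Lₘ]` gives `μₘ := e^{σₘ} ≥ m+1` with `nsRescale (μₘ) W` `1/(m+1)`-close to `W` on slab `m`, whence slice-wise
  locally uniform convergence; `λₙ ≥ n+1` by thinning the `Ω`-witness of `W`.

WHAT THIS IS NOT: not a claim about Navier–Stokes regularity — a support stub (U2d) of a PASSed files-only line of a door route (bears_on LADDER-NS N0,
rung N0-LocalTubeDoorPoloidal); its analytic partner U2b `ParaboloidGap` is a separate hand (ns-es-p1); the research cell `CellDefectiveReturnLeafCore`
(inherits the KNSS-(L)/DSS Liouville wall), S0 and ⟨27893⟩ stay OPEN; crux 19708 / item 20428 OPEN; NS regularity NOT proved.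
-/

noncomputable section

-- the summit and its single sub-problem share the name (CONVENTIONS §1), as in every Theorems file
set_option linter.dupNamespace false

namespace Summit.NavierStokesRegularity.NavierStokesRegularity.Theorems.PoloidalWindowDoorPoloidalWindowRigidityEternalCoreScalingRecurrentCore

open Set Function Filter Topology Metric
open scoped InnerProductSpace RealInnerProductSpace NNReal
open Literature.Analysis Literature.Analysis.FluidPDE Literature.Analysis.UnboundedOperators
open Summit.NavierStokesRegularity.NavierStokesRegularity.Theorems
open PoloidalWindowDoorPoloidalWindowRigidityHotHullSlabUniform PoloidalWindowDoorPoloidalWindowRigidityEternalCoreScalingCore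
  PoloidalWindowDoorPoloidalWindowRigidityEternalCoreScalingRecurrence PoloidalWindowDoorPoloidalWindowRigidityPoloidalExtremal

/-- Locally uniform convergence along `atTop` survives re-indexing along a sequence tending to `atTop`. -/
theorem tendstoLocallyUniformly_subseq {α β : Type*} [TopologicalSpace α] [UniformSpace β] {F : ℕ → α → β} {f : α → β}
    (h : TendstoLocallyUniformly F f atTop) {ψ : ℕ → ℕ} (hψ : Tendsto ψ atTop atTop) :
    TendstoLocallyUniformly (fun n => F (ψ n)) f atTop := fun u hu x => by
  obtain ⟨t, ht, hev⟩ := h u hu x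
  exact ⟨t, ht, hψ.eventually hev⟩

/-- **Diagonal lemma for blow-down limits**: a slice-wise limit of blow-down limits of `U` is a blow-down limit of `U`. -/
theorem scaling_diagonal {C : ℝ} {U W : ℝ → EuclideanSpace ℝ (Fin 3) → EuclideanSpace ℝ (Fin 3)} (hU : IsTypeIAncientMild C U)
    {Ws : ℕ → ℝ → EuclideanSpace ℝ (Fin 3) → EuclideanSpace ℝ (Fin 3)} {lams : ℕ → ℕ → ℝ}
    (hWs : ∀ j, IsTypeIAncientMild C (Ws j)) (hpos : ∀ j n, 0 < lams j n) (hlams : ∀ j, Tendsto (lams j) atTop atTop)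
    (hconvj : ∀ j, ∀ t < 0, TendstoLocallyUniformly (fun n => nsRescale (lams j n) U t) (Ws j t) atTop)
    (hW : IsTypeIAncientMild C W) (hlim : ∀ t < 0, TendstoLocallyUniformly (fun j => Ws j t) (W t) atTop) :
    ∃ lam : ℕ → ℝ, (∀ j, 0 < lam j) ∧ Tendsto lam atTop atTop ∧
      ∀ t < 0, TendstoLocallyUniformly (fun j => nsRescale (lam j) U t) (W t) atTop := by
  classical
  let Sn : ℕ → Set (ℝ × EuclideanSpace ℝ (Fin 3)) := fun n =>
    Icc (-((n : ℝ) + 2)) (-((n : ℝ) + 2)⁻¹) ×ˢ closedBall (0 : EuclideanSpace ℝ (Fin 3)) ((n : ℝ) + 2)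
  have hn2 : ∀ n : ℕ, (1 : ℝ) ≤ (n : ℝ) + 2 := fun n => by have := n.cast_nonneg (α := ℝ); linarith
  have hR : ∀ j n, IsTypeIAncientMild C (nsRescale (lams j n) U) := fun j n => isTypeIAncientMild_nsRescale hU (hpos j n)
  have hWc : ∀ j, ∀ t < 0, Continuous (Ws j t) := fun j t ht => ((hWs j).analyticOnNhd_slice_univ ht).continuous
  have hslabj : ∀ j n, TendstoUniformlyOn (fun k (p : ℝ × EuclideanSpace ℝ (Fin 3)) => nsRescale (lams j k) U p.1 p.2) (uncurry (Ws j)) atTop (Sn n) :=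
    fun j n => tendstoUniformlyOn_slab C (u := fun k => nsRescale (lams j k) U) (U := Ws j) (fun k => (hR j k).hasTypeITimeDecay)
      (fun k => (hR j k).continuousOn_uncurry) (fun k s t hst ht x => (hR j k).mild_eq_heatExtension hst ht x) (fun k t ht => (hR j k).isDivFree ht)
      (hWs j).hasTypeITimeDecay (hWs j).continuousOn_uncurry (fun s t hst ht x => (hWs j).mild_eq_heatExtension hst ht x)
      (fun t ht => (hWs j).isDivFree ht) (fun t ht x => (hconvj j t ht).tendsto_comp ((hWc j t ht).continuousAt) tendsto_const_nhds) (hn2 n)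
  have hWcU : ∀ t < 0, Continuous (W t) := fun t ht => (hW.analyticOnNhd_slice_univ ht).continuous
  have hslabU : ∀ n, TendstoUniformlyOn (fun j (p : ℝ × EuclideanSpace ℝ (Fin 3)) => Ws j p.1 p.2) (uncurry W) atTop (Sn n) :=
    fun n => tendstoUniformlyOn_slab C (u := Ws) (U := W) (fun j => (hWs j).hasTypeITimeDecay) (fun j => (hWs j).continuousOn_uncurry)
      (fun j s t hst ht x => (hWs j).mild_eq_heatExtension hst ht x) (fun j t ht => (hWs j).isDivFree ht) hW.hasTypeITimeDecay hW.continuousOn_uncurry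
      (fun s t hst ht x => hW.mild_eq_heatExtension hst ht x) (fun t ht => hW.isDivFree ht)
      (fun t ht x => (hlim t ht).tendsto_comp ((hWcU t ht).continuousAt) tendsto_const_nhds) (hn2 n)
  have hchoice : ∀ j : ℕ, ∃ k : ℕ, (j : ℝ) + 1 ≤ lams j k ∧
      ∀ p ∈ Sn j, dist (Ws j p.1 p.2) (nsRescale (lams j k) U p.1 p.2) < 1 / ((j : ℝ) + 1) := by
    intro j
    have h1 : ∀ᶠ k in atTop, (j : ℝ) + 1 ≤ lams j k := (hlams j).eventually (eventually_ge_atTop _)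
    have h2 := Metric.tendstoUniformlyOn_iff.1 (hslabj j j) _ (by positivity : (0 : ℝ) < 1 / ((j : ℝ) + 1))
    obtain ⟨k, hk1, hk2⟩ := (h1.and h2).exists
    exact ⟨k, hk1, hk2⟩
  choose ks hks using hchoice
  refine ⟨fun j => lams j (ks j), fun j => hpos j (ks j), ?_, ?_⟩
  · refine tendsto_atTop_mono (fun j => (hks j).1) ?_
    exact tendsto_atTop_add_const_right _ 1 tendsto_natCast_atTop_atTop
  · intro t ht
    rw [tendstoLocallyUniformly_iff_forall_isCompact]
    intro Kc hKc
    obtain ⟨r, hr⟩ := hKc.isBounded.subset_closedBall 0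
    obtain ⟨n, hn⟩ := exists_nat_ge (max (max r (-t)) (-t)⁻¹)
    have hnr : r ≤ (n : ℝ) + 2 := by linarith [le_max_left (max r (-t)) (-t)⁻¹, le_max_left r (-t)]
    have ht1 : -((n : ℝ) + 2) ≤ t := by linarith [le_max_left (max r (-t)) (-t)⁻¹, le_max_right r (-t)]
    have ht2 : t ≤ -((n : ℝ) + 2)⁻¹ := by
      have h1 : (-t)⁻¹ ≤ (n : ℝ) + 2 := by linarith [le_max_right (max r (-t)) (-t)⁻¹]
      have h2 : ((n : ℝ) + 2)⁻¹ ≤ -t := inv_le_of_inv_le₀ (by linarith) h1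
      linarith
    rw [Metric.tendstoUniformlyOn_iff]
    intro ε hε
    obtain ⟨m, hm⟩ := exists_nat_gt (2 / ε)
    have hU' := Metric.tendstoUniformlyOn_iff.1 (hslabU n) (ε / 2) (half_pos hε)
    filter_upwards [hU', eventually_ge_atTop (max n m)] with j hj hjm x hx
    have hjn : n ≤ j := le_trans (le_max_left _ _) hjm
    have hjm' : m ≤ j := le_trans (le_max_right _ _) hjm
    have hp : (t, x) ∈ Sn n := mem_prod.2 ⟨⟨ht1, ht2⟩, closedBall_subset_closedBall hnr (hr hx)⟩
    have hpj : (t, x) ∈ Sn j := by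
      have hnj : (n : ℝ) + 2 ≤ (j : ℝ) + 2 := by have := Nat.cast_le (α := ℝ).2 hjn; linarith
      refine mem_prod.2 ⟨⟨by linarith, le_trans ht2 ?_⟩, closedBall_subset_closedBall (hnr.trans hnj) (hr hx)⟩
      rw [neg_le_neg_iff]
      exact inv_anti₀ (by linarith [hn2 n]) hnj
    have hsmall : 1 / ((j : ℝ) + 1) < ε / 2 := by
      have hj1 : (2 / ε : ℝ) < (j : ℝ) + 1 := by
        have := Nat.cast_le (α := ℝ).2 hjm'
        linarith
      rw [div_lt_iff₀ (by positivity)]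
      rw [div_lt_iff₀ hε] at hj1
      linarith
    calc dist (W t x) (nsRescale (lams j (ks j)) U t x)
        ≤ dist (W t x) (Ws j t x) + dist (Ws j t x) (nsRescale (lams j (ks j)) U t x) := dist_triangle _ _ _
      _ < ε / 2 + ε / 2 := add_lt_add (hj (t, x) hp) (((hks j).2 (t, x) hpj).trans hsmall)
      _ = ε := add_halves ε

/-- **U2d `ScalingRecurrentCore` of LINE 23 «eternal_core» (VERBATIM; `EternalCore` unfolded).**  See the module docstring. -/
theorem scalingRecurrentCore :
    ∀ (C M ε₀ R₀ : ℝ) (U : ℝ → EuclideanSpace ℝ (Fin 3) → EuclideanSpace ℝ (Fin 3)), IsTypeIAncientMild C U →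
      (∀ s < 0, ∀ y, ⟪Literature.Analysis.FluidPDE.curl (U s) y, EuclideanSpace.single 2 1⟫_ℝ = 0) →
      (∀ t < 0, ∀ x, Real.sqrt (-t) * |U t x 2| ≤ M) →
      0 < ε₀ → (∀ t₀ : ℝ, t₀ < (-1) → ∃ r ∈ Set.Icc (4 * t₀) t₀, ∃ y : EuclideanSpace ℝ (Fin 3),
        ‖y‖ ≤ R₀ * Real.sqrt (-r) ∧ ε₀ ≤ Real.sqrt (-r) * ‖U r y‖) →
      ∃ (lam : ℕ → ℝ) (W : ℝ → EuclideanSpace ℝ (Fin 3) → EuclideanSpace ℝ (Fin 3)) (mu : ℕ → ℝ),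
        (∀ n : ℕ, (n : ℝ) + 1 ≤ lam n) ∧ IsTypeIAncientMild C W ∧
        (∀ t < 0, TendstoLocallyUniformly (fun n => nsRescale (lam n) U t) (W t) Filter.atTop) ∧
        (∀ s < 0, ∀ y, ⟪Literature.Analysis.FluidPDE.curl (W s) y, EuclideanSpace.single 2 1⟫_ℝ = 0) ∧
        (∀ t < 0, ∀ x, Real.sqrt (-t) * |W t x 2| ≤ M) ∧
        (∀ t₀ : ℝ, t₀ < 0 → ∃ r ∈ Set.Icc (4 * t₀) t₀, ∃ y : EuclideanSpace ℝ (Fin 3),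
          ‖y‖ ≤ R₀ * Real.sqrt (-r) ∧ ε₀ ≤ Real.sqrt (-r) * ‖W r y‖) ∧
        (∀ n : ℕ, (n : ℝ) + 1 ≤ mu n) ∧
        (∀ t < 0, TendstoLocallyUniformly (fun n => nsRescale (mu n) W t) (W t) Filter.atTop) := by
  intro C M ε₀ R₀ U hU hpol hext hε₀ hcore
  classical
  -- pointwise facts that pass to slice-wise limits
  have hc2 : Continuous fun v : EuclideanSpace ℝ (Fin 3) => v 2 := (EuclideanSpace.proj (𝕜 := ℝ) (2 : Fin 3)).continuous
  have hext_lim : ∀ {Vs : ℕ → ℝ → EuclideanSpace ℝ (Fin 3) → EuclideanSpace ℝ (Fin 3)} {V : ℝ → EuclideanSpace ℝ (Fin 3) → EuclideanSpace ℝ (Fin 3)},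
      (∀ j, (∀ t < 0, ∀ x, Real.sqrt (-t) * |Vs j t x 2| ≤ M)) → (∀ t < 0, ∀ x, Tendsto (fun j => Vs j t x) atTop (𝓝 (V t x))) → (∀ t < 0, ∀ x, Real.sqrt (-t) * |V t x 2| ≤ M) := by
    intro Vs V hVs hpt t ht x
    have hl : Tendsto (fun j => Real.sqrt (-t) * |Vs j t x 2|) atTop (𝓝 (Real.sqrt (-t) * |V t x 2|)) :=
      ((continuous_const.mul (continuous_abs.comp hc2)).tendsto _).comp (hpt t ht x)
    exact le_of_tendsto hl (Eventually.of_forall fun j => hVs j t ht x)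
  -- the blow-down hull
  set Ω : Set (ℝ → EuclideanSpace ℝ (Fin 3) → EuclideanSpace ℝ (Fin 3)) := {W | IsTypeIAncientMild C W ∧
    (∀ s < 0, ∀ y, ⟪Literature.Analysis.FluidPDE.curl (W s) y, EuclideanSpace.single 2 1⟫_ℝ = 0) ∧
    (∀ t < 0, ∀ x, Real.sqrt (-t) * |W t x 2| ≤ M) ∧
    (∀ t₀ : ℝ, t₀ < 0 → ∃ r ∈ Set.Icc (4 * t₀) t₀, ∃ y : EuclideanSpace ℝ (Fin 3),
      ‖y‖ ≤ R₀ * Real.sqrt (-r) ∧ ε₀ ≤ Real.sqrt (-r) * ‖W r y‖) ∧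
    ∃ lam : ℕ → ℝ, (∀ n, 0 < lam n) ∧ Tendsto lam atTop atTop ∧
      ∀ t < 0, TendstoLocallyUniformly (fun n => nsRescale (lam n) U t) (W t) atTop} with hΩ
  -- (Ω1) non-empty: a blow-down limit along `λₙ = n + 1`
  have hVn : ∀ n : ℕ, IsTypeIAncientMild C (nsRescale ((n : ℝ) + 1) U) := fun n => isTypeIAncientMild_nsRescale hU (by positivity)
  obtain ⟨φ0, hφ0, W0, hW0, hpt0, hfd0, htlu0, -⟩ := exists_tendsto_of_isTypeIAncientMild_seq C hVn
  have hlam0 : Tendsto (fun j => (φ0 j : ℝ) + 1) atTop atTop :=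
    tendsto_atTop_add_const_right _ 1 (tendsto_natCast_atTop_atTop.comp hφ0.tendsto_atTop)
  have hW0Ω : W0 ∈ Ω := by
    refine ⟨hW0, fun s hs y => poloidal_of_tendsto (hfd0 s hs y) fun j => poloidal_nsRescale hpol (by positivity) s hs y,
      hext_lim (fun j => extremal_nsRescale hext (by positivity : (0 : ℝ) < (φ0 j : ℝ) + 1)) hpt0, ?_,
      fun j => (φ0 j : ℝ) + 1, fun j => by positivity, hlam0, htlu0⟩
    refine eternalCore_of_limit C ε₀ R₀ 0 le_rfl (fun j => hVn (φ0 j)) hW0 hpt0 fun t₀ ht₀ => ?_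
    have hev : ∀ᶠ j in atTop, ((φ0 j : ℝ) + 1) ^ 2 * t₀ < -1 := by
      obtain ⟨m, hm⟩ := exists_nat_gt (-t₀)⁻¹
      filter_upwards [hlam0.eventually (eventually_ge_atTop ((m : ℝ) + 1))] with j hj
      have h0 : 0 < -t₀ := by linarith
      have h1 : (-t₀)⁻¹ < (φ0 j : ℝ) + 1 := by linarith
      have h2 : 1 < ((φ0 j : ℝ) + 1) * (-t₀) := by
        have := (inv_lt_iff_one_lt_mul₀ h0).1 h1
        linarith
      have h3 : ((φ0 j : ℝ) + 1) * (-t₀) ≤ ((φ0 j : ℝ) + 1) ^ 2 * (-t₀) := by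
        have h4 : (φ0 j : ℝ) + 1 ≤ ((φ0 j : ℝ) + 1) ^ 2 := by nlinarith [(φ0 j).cast_nonneg (α := ℝ)]
        exact mul_le_mul_of_nonneg_right h4 h0.le
      nlinarith
    exact hev.mono fun j hj => eternalCore_nsRescale hcore (by positivity : (0 : ℝ) < (φ0 j : ℝ) + 1) t₀ hj
  -- (Ω2) class, (Ω3) scaling invariance
  have hcls : ∀ W ∈ Ω, IsTypeIAncientMild C W := fun W hW => hW.1
  have hinv : ∀ W ∈ Ω, ∀ σ : ℝ, nsRescale (Real.exp σ) W ∈ Ω := by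
    rintro W ⟨hWc, hWp, hWe, hWk, lam, hlp, hla, hconv⟩ σ
    have hσ : 0 < Real.exp σ := Real.exp_pos σ
    refine ⟨isTypeIAncientMild_nsRescale hWc hσ, poloidal_nsRescale hWp hσ, extremal_nsRescale hWe hσ,
      fun t₀ ht₀ => eternalCore_nsRescale hWk hσ t₀ (mul_neg_of_pos_of_neg (pow_pos hσ 2) ht₀),
      fun n => lam n * Real.exp σ, fun n => mul_pos (hlp n) hσ, hla.atTop_mul_const hσ, ?_⟩
    intro t ht
    have e : (fun n => nsRescale (lam n * Real.exp σ) U t) = fun n => nsRescale (Real.exp σ) (nsRescale (lam n) U) t := by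
      funext n
      rw [nsRescale_mul]
    rw [e]
    exact tendsto_nsRescale_slices (Ws := fun n => nsRescale (lam n) U) hconv hσ t ht
  -- (Ω4) sequential compactness and closedness
  have hcpt : ∀ Us : ℕ → ℝ → EuclideanSpace ℝ (Fin 3) → EuclideanSpace ℝ (Fin 3), (∀ k, Us k ∈ Ω) →
      ∃ (φ : ℕ → ℕ) (W : ℝ → EuclideanSpace ℝ (Fin 3) → EuclideanSpace ℝ (Fin 3)), StrictMono φ ∧ W ∈ Ω ∧
        (∀ t < 0, TendstoLocallyUniformly (fun j => Us (φ j) t) (W t) atTop) := by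
    intro Us hUs
    obtain ⟨φ, hφ, W, hW, hpt, hfd, htlu, -⟩ := exists_tendsto_of_isTypeIAncientMild_seq C fun k => (hUs k).1
    choose lams hlp hla hconvj using fun j => (hUs (φ j)).2.2.2.2
    obtain ⟨lam, hlam_pos, hlam, hconv⟩ := scaling_diagonal hU (Ws := fun j => Us (φ j)) (lams := lams) (fun j => (hUs (φ j)).1) hlp hla hconvj hW htlu
    refine ⟨φ, W, hφ, ⟨hW, fun s hs y => poloidal_of_tendsto (hfd s hs y) fun j => (hUs (φ j)).2.1 s hs y,
      hext_lim (fun j => (hUs (φ j)).2.2.1) hpt, ?_, lam, hlam_pos, hlam, hconv⟩, htlu⟩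
    exact eternalCore_of_limit C ε₀ R₀ 0 le_rfl (fun j => (hUs (φ j)).1) hW hpt fun t₀ ht₀ =>
      Eventually.of_forall fun j => (hUs (φ j)).2.2.2.1 t₀ ht₀
  -- Birkhoff recurrence under scaling
  obtain ⟨W, hWΩ, hrec⟩ := exists_scaling_recurrent C Ω ⟨W0, hW0Ω⟩ hcls hcpt hinv
  obtain ⟨hWc, hWp, hWe, hWk, lam, hlp, hla, hconv⟩ := hWΩ
  -- thin the witness to `λₙ ≥ n + 1`
  obtain ⟨ψ, hψ, hψge⟩ := Filter.extraction_forall_of_eventually (fun n : ℕ => hla.eventually (eventually_ge_atTop ((n : ℝ) + 1)))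
  -- the scaling returns
  have hret := fun m : ℕ => hrec (1 / ((m : ℝ) + 1)) (by positivity) m
  choose L hL hwin using hret
  choose σm hσm hσm1 using fun m : ℕ => hwin m (Real.log ((m : ℝ) + 1))
  have hn2 : ∀ n : ℕ, (1 : ℝ) ≤ (n : ℝ) + 2 := fun n => by have := n.cast_nonneg (α := ℝ); linarith
  refine ⟨fun n => lam (ψ n), W, fun m => Real.exp (σm m), hψge, hWc,
    fun t ht => tendstoLocallyUniformly_subseq (hconv t ht) hψ.tendsto_atTop, hWp, hWe, hWk, fun m => ?_, fun t ht => ?_⟩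
  · have h1 : Real.log ((m : ℝ) + 1) ≤ σm m := (hσm m).1
    calc (m : ℝ) + 1 = Real.exp (Real.log ((m : ℝ) + 1)) := (Real.exp_log (by positivity)).symm
      _ ≤ Real.exp (σm m) := Real.exp_le_exp.2 h1
  · rw [tendstoLocallyUniformly_iff_forall_isCompact]
    intro Kc hKc
    obtain ⟨r, hr⟩ := hKc.isBounded.subset_closedBall 0
    obtain ⟨n, hn⟩ := exists_nat_ge (max (max r (-t)) (-t)⁻¹)
    have hnr : r ≤ (n : ℝ) + 2 := by linarith [le_max_left (max r (-t)) (-t)⁻¹, le_max_left r (-t)]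
    have ht1 : -((n : ℝ) + 2) ≤ t := by linarith [le_max_left (max r (-t)) (-t)⁻¹, le_max_right r (-t)]
    have ht2 : t ≤ -((n : ℝ) + 2)⁻¹ := by
      have h1 : (-t)⁻¹ ≤ (n : ℝ) + 2 := by linarith [le_max_right (max r (-t)) (-t)⁻¹]
      have h2 : ((n : ℝ) + 2)⁻¹ ≤ -t := inv_le_of_inv_le₀ (by linarith) h1
      linarith
    rw [Metric.tendstoUniformlyOn_iff]
    intro ε hε
    obtain ⟨m₁, hm₁⟩ := exists_nat_gt (1 / ε)
    filter_upwards [eventually_ge_atTop (max n m₁)] with m hm x hx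
    have hmn : n ≤ m := le_trans (le_max_left _ _) hm
    have hmm : (m₁ : ℝ) ≤ m := Nat.cast_le.2 (le_trans (le_max_right _ _) hm)
    have hnm' : (n : ℝ) + 2 ≤ (m : ℝ) + 2 := by have := Nat.cast_le (α := ℝ).2 hmn; linarith
    have htm : t ∈ Icc (-((m : ℝ) + 2)) (-((m : ℝ) + 2)⁻¹) := by
      refine ⟨by linarith, le_trans ht2 ?_⟩
      rw [neg_le_neg_iff]
      exact inv_anti₀ (by linarith [hn2 n]) hnm'
    have hxm : x ∈ closedBall (0 : EuclideanSpace ℝ (Fin 3)) ((m : ℝ) + 2) := closedBall_subset_closedBall (hnr.trans hnm') (hr hx)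
    have hsmall : 1 / ((m : ℝ) + 1) < ε := by
      rw [div_lt_iff₀ (by positivity)]
      rw [div_lt_iff₀ hε] at hm₁
      nlinarith
    rw [dist_comm]
    exact (hσm1 m t htm x hxm).trans hsmall

end Summit.NavierStokesRegularity.NavierStokesRegularity.Theorems.PoloidalWindowDoorPoloidalWindowRigidityEternalCoreScalingRecurrentCore

end
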